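/-
Copyright: cell `pub-ymgap` (HUMAN RULING D-0062), Track A of `YM-PLAN.md`, DAG node N20 (= NE7b); R134 acceleration seat
`pub-ymgap-dag-n20-c` (strategy s1, generation 10), module 52.  Released under the licence of the surrounding project.
-/
import Summits.QuantumFields.YangMills.Theorems.BalabanUVNodesN20LCSCanonicalSkeleton
import HarnessLib

/-!
# YM-DAG node N20 (= NE7b), row s1, module 52: THE REGIME IS «COUPLINGS SUFFICIENTLY SMALL AT THE PINNED LEVELS», LITERALLY — the instance for
# arbitrary pinned families with a PER-LEVEL threshold `4N·B²·(Λ + log m_j∕δ) ≤ p₀(g_{j+1})²` at the EXPLICIT region size `m_j = d²(9LM₂R_{j+1})^d`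
# (no free `m`, `γ`, `X`), one level-uniform Peierls factor `e^{−δΛ∕39^d}` per pinned cube; and an EXPLICIT `g⋆` below which the threshold holds

Track A of `YM-PLAN.md` (cell `pub-ymgap`, HUMAN RULING D-0062), node **N20** = spine estimate NE7b (`T4WeightBudget.RelWeightBound`, NOT
PRINTED, NOT PROVED).  Seat `pub-ymgap-dag-n20-c` (R134, s1), generation 10, module 52 (imports module 51 `…N20LCSCanonicalSkeleton`).  Kernel theorems
only: 0 `def`, 0 `sorry`, standard axioms; COUNT-NEUTRAL.  Real arithmetic and bookkeeping over modules 47 ∕ 48 ∕ 51; it asserts nothing of Bałaban's.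

WHY.  Module 48 §2 ∕ 49 §4 ∕ 51 §3 state the regime (R) with LEVEL-UNIFORM bookkeeping numbers: one region size `m` (with the floor
`d²(9LM₂R_{j+1})^d ≤ m` at every pinned level, module 51), one ceiling `γ` on the pinned couplings and one threshold `(X∕A₀²)^{1∕(2p₀)} ≤ log γ⁻²`,
`X = 4N·B²·(C·A·M_h² + log m∕δ)`.  Along Bałaban's flow the region size GROWS (`R_{j+1} = R(g_{j+1})` of (2.5) grows like `(log g_{j+1}⁻²)^r` as the
coupling decreases), so a single `m` is an artefact of the display.  Print's regime is per level: *«for g_k sufficiently small»*.  THIS FILE states it so: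
* §1 ★★★ **`sum_admS_integral_le_rec_pinnedLevels_smallCouplings_of_any`** — the instance for ARBITRARY pinned families (module 51 §3's skeleton and
  size theorems inside) with the regime replaced by the PER-LEVEL THRESHOLD `hsmall : ∀ j ∈ J, 4N·B²·(Λ + log m_j∕δ) ≤ p₀(g_{j+1})²` at the EXPLICIT size
  `m_j = d²·(9·L·M₂·R_{j+1})^d`, `R_{j+1} = RkOfRecord L r g_{j+1}` — a condition on the coupling `g_{j+1}` and the constants ALONE (`Λ = C·A·M_h²`;
  module 47 §1 `pow_mul_exp_le_exp_neg_mul` level by level at the exact gain `g⁻²(ε(g)∕B)² = p₀(g)²∕B²`, module 48 §1 on the skeleton) — and ONE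
  LEVEL-UNIFORM PEIERLS FACTOR `e^{−δΛ∕39^d}` per pinned cube (the level-dependent surplus `log m_j` of the threshold pays the region's entropy exactly);
  no `m`, `γ`, `X`, `hlog`, `hmJ` binders remain.
* §2 `RkOfRecord_le_mul_pow` (`R(g) ≤ L·(log g⁻²)^r` once `(log g⁻²)^r ≥ 1`: minimality in (2.5)); ★★ **`threshold_le_p0Profile_sq_of_le_gstar`** — the
  per-level threshold HOLDS for every coupling `0 < g ≤ g⋆ := exp(−t₀∕2)`, `t₀ = max 1 ((a + b)∕A₀²)`, `a = 4N·B²·(Λ + log(d²(9L²M₂)^d)∕δ)`,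
  `b = 4N·B²·r·d∕δ` (elementary: `log m(g) ≤ log(d²(9L²M₂)^d) + r·d·log t`, `log t ≤ t ≤ t² ≤ t^{2p₀}` for `t = log g⁻² ≥ 1`) — print's «sufficiently
  small», with an explicit (crude) `g⋆` in the constants `N, B, Λ, δ, A₀, p₀, d, L, M₂, r`.
* (module 53 `…N20LCSSmallCouplingInstance` composes §1 and §2: the instance for arbitrary pinned families whenever the pinned-level couplings satisfy
  `0 < g_{j+1} ≤ g⋆`, MODULO (W♮) + (T♮) and the side conditions among the free constants `α, δ, a₀, C, B` — module 49 §5 `regime_inhabited`.)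

HONEST FRAMING.  Bookkeeping and elementary real arithmetic; no estimate of Bałaban's.  (W♮) ((A1c), THE wall, NOT PRINTED as a statement) and (T♮)
([Balaban1985Variational] Thm 1 (9) for the LOCAL (2.16) problems of record — K0's pen) stay DISPLAYED; `M ≫ M₂` (module 43, the separation letters of
42–44) stays a displayed numerics side condition of the lineage.  `g⋆` is crude (no attempt at print's constants).  NE7b NOT PRINTED ∕ NOT PROVED;
(α)-instance 0∕1; N20 NOT discharged; typed 28∕28, count untouched; one finite four-torus at fixed `ε` — NOT ℝ⁴, NOT infinite volume, NOT OS, NOT a mass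
gap, NOT Clay.

References (LOCATORS): T. Bałaban, CMP 119 (1988) 243–285 [Balaban1988Convergent] ((2.4)–(2.5) p.255, (2.16)–(2.17) p.257, (3.2) p.265); CMP 122 (1989)
355–392 [Balaban1989LargeFieldII] ((1.79)–(1.80) pp.383–384, p.383 l.21–28 «we estimate the factors by exp(−p₀(g_j))»); CMP 109 (1987) 249–301
[Balaban1987RG1] (Thm 2 p.259: the couplings stay in `]0, γ]`); CMP 102 (1985) 277–309 [Balaban1985Variational] (Thm 1 (9) p.279).
-/

set_option autoImplicit false

noncomputable section

open scoped BigOperators ENNReal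

namespace Summit.QuantumFields.YangMills.BalabanUVNodes.N20LCSSmallCouplingRegime

open MeasureTheory
open Literature.MathematicalPhysics.QuantumFieldTheory.Balaban1983to89
open Literature.MathematicalPhysics.QuantumFieldTheory.Balaban1983to89.T4Continuum
open Literature.MathematicalPhysics.QuantumFieldTheory.Balaban1983to89.B14.Eq218Concrete
open Literature.MathematicalPhysics.QuantumFieldTheory.Balaban1983to89.Node00
open B15DeterminingSets B14.Eq213DetSet B14.Eq216Concrete B14.Eq213MaximalDomains B15Eq112TorusCover B14DomainGeom
open Literature.MathematicalPhysics.QuantumFieldTheory.BalabanImbrieJaffe1984to88.BIJ85Eq453GaugeField (qsstarGIter0)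
open ExpMeanLog (deltaSU)
open Summit.QuantumFields.BalabanUV.T4Continuum.B16HistoryIndexedRepr (GoodClass)
open Summit.QuantumFields.BalabanUV.T4Continuum.B16HistoryReprChain
open Summit.QuantumFields.BalabanUV.T4Continuum.NE7b.PrefixExtraction (admS)
open Summit.QuantumFields.YangMills.BalabanUVNodes.N20LCSLabelTower
open Summit.QuantumFields.YangMills.BalabanUVNodes.N20LCSAvgDominationRegion (boxRegion)
open Literature.MathematicalPhysics.QuantumFieldTheory.Balaban1983to89.B14SeparationOfRecord (one_le_RkOfRecord)
open Summit.QuantumFields.YangMills.BalabanUVNodes.N20LCSPeierlsRegime (pow_mul_exp_le_exp_neg_mul inv_sq_mul_div_sq)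
open Summit.QuantumFields.YangMills.BalabanUVNodes.N20LCSInstanceModuloTwo (sum_admS_integral_le_rec_pinnedLevels_hullWindow_of_regularity)
open Summit.QuantumFields.YangMills.BalabanUVNodes.N20LCSCanonicalRegion (mem_canon_iff)
open Summit.QuantumFields.YangMills.BalabanUVNodes.N20LCSCanonicalSkeleton (exists_canon_skeleton card_canon_le hLSw_of_window)

/-! ## §1 The instance for arbitrary pinned families with the PER-LEVEL small-coupling threshold -/

section PerLevel

variable (F : T4Family) (N : ℕ) [NeZero N] (ν : Stage7Numerics) (M : ℕ) (p : B12.RunParams) (g : ℕ → ℝ) (A₁ : ℝ)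

/-- The explicit region size `m_j = d²(9LM₂R_{j+1})^d` is `≥ 1` (`1 ≤ d`, `0 < L`, `0 < M₂`, `1 ≤ R_{j+1}`). [cite: Balaban1988Convergent, (2.5) p.255, (2.17) p.257 (bookkeeping)] -/
theorem one_le_regionSize (hM₂ : 0 < ν.M₂) (j : ℕ) :
    (1 : ℝ) ≤ (((F.P p.K).d ^ 2 * (9 * ((F.P p.K).L * ν.M₂ * RkOfRecord (F.P p.K).L ν.r (g (j + 1)))) ^ (F.P p.K).d : ℕ) : ℝ) := by
  have hd : 0 < (F.P p.K).d := (F.P p.K).hd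
  have hR : 0 < RkOfRecord (F.P p.K).L ν.r (g (j + 1)) := one_le_RkOfRecord (F.P p.K).L_pos _ _
  have h : 0 < (F.P p.K).d ^ 2 * (9 * ((F.P p.K).L * ν.M₂ * RkOfRecord (F.P p.K).L ν.r (g (j + 1)))) ^ (F.P p.K).d :=
    Nat.mul_pos (pow_pos hd 2) (pow_pos (Nat.mul_pos (by norm_num) (Nat.mul_pos (Nat.mul_pos (F.P p.K).L_pos hM₂) hR)) _)
  exact_mod_cast h

open Classical in
/-- ★★★ **THE INSTANCE AT THE RECORD FOR ARBITRARY PINNED FAMILIES, IN THE PER-LEVEL SMALL-COUPLING REGIME, MODULO (W♮) + (T♮).**  On Bałaban's label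
tower at the residual of record, for a bounded measurable `ρ₀ ≥ 0`, pinned levels `J` (`j < K`) with ARBITRARY families `D_j` of χ_{j+1}-cubes, constants
`0 < B`, `0 < α` (averaging guard), `0 ≤ C`, `0 < δ`, `δ·A·M_h ≤ a₀`: IF (W♮) «LCS-j on the hull of the (3.2) window's canonical regions» holds with
constant `C`, (T♮) holds at every cube, AND THE PINNED-LEVEL COUPLINGS ARE SMALL in the literal per-level sense
`hsmall : 4N·B²·(C·A·M_h² + log(d²(9LM₂R_{j+1})^d)∕δ) ≤ p₀(g_{j+1})²` (`p₀(g) = A₀(log g⁻²)^{p₀}`, `R_{j+1} = R(g_{j+1})` of (2.5)), THEN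
`Σ_{h ∈ class K′} ∫ eterm ρ₀ K′ h dμ_{K′} ≤ exp(−(δ·C·A·M_h²∕39^d)·Σ_{j<K′, j∈J} #D_j)·∫ρ₀ dU₀` — ONE LEVEL-UNIFORM PEIERLS FACTOR PER PINNED CUBE, no
free `m`, `γ`, `X`. [cite: Balaban1989LargeFieldII, (1.79)–(1.80) pp.383–384, p.383 l.21–28; Balaban1985Variational, Thm 1 (9) p.279; Balaban1988Convergent, (2.4)–(2.5) p.255] -/
theorem sum_admS_integral_le_rec_pinnedLevels_smallCouplings_of_any {ρ₀ : cfgOfRecord F N p.K 0 → ℝ}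
    (hρ : (bddMeas (cfgOfRecord F N p.K 0)).Gd ρ₀) (h0 : ∀ U, 0 ≤ ρ₀ U) (hM₂ : 0 < ν.M₂)
    (J : Finset ℕ) (hJ : ∀ j ∈ J, j < p.K)
    (D : (j : ℕ) → Finset (Iχ F ν p g j)) {B : ℝ} (hB : 0 < B)
    (hg : ∀ j ∈ J, 0 < g (j + 1))
    (hεη : ∀ j ∈ J, 0 < epsOfRecord ν g (j + 1) * (F.P p.K).eta (j + 1) ^ 2)
    (hThm1 : ∀ j ∈ J, ∀ (c : Iχ F ν p g j) (V' : GaugeField (F.P p.K) (j + 1) (SU N)) (U₀ : GaugeField (F.P p.K) 0 (SU N)),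
      IsMinimizer (avOfRecord F N p.K) {U | PlaqSmall (ν.εreg * (F.P p.K).eta (j + 1) ^ 2) U}
          (Bj ν.M₁ (cubeEnl (F.P p.K) (sideχ F ν p g j) c 4) (j + 1)) (avgFamily (avOfRecord F N p.K) (qsstarGIter0 (j + 1) V')) U₀ →
      (∀ p' : Plaq (F.P p.K) (j + 1), embIter (j + 1) p'.src ∈ cubeEnl (F.P p.K) (sideχ F ν p g j) c 4 →
        dist1 (GaugeField.plaqHol V' p') < epsOfRecord ν g (j + 1) / B) →
      PlaqSmallOn (plaqInside (cubeEnl (F.P p.K) (sideχ F ν p g j) c 1)) (epsOfRecord ν g (j + 1) * (F.P p.K).eta (j + 1) ^ 2) U₀)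
    {α C a₀ δ : ℝ} (hα : 0 < α)
    (hguard : (((((F.P p.K).d + 2) * (F.P p.K).L : ℕ) : ℝ) ^ 2 / 4) * Real.sqrt (2 * (Fintype.card (Fin N) : ℝ) * α) < deltaSU (Fin N))
    (hC : 0 ≤ C) (hδ : 0 < δ)
    (hδa : δ * ((2 * (Fintype.card (Fin N) : ℝ) * (((F.P p.K).L : ℝ) ^ 2 + 6 * ((((F.P p.K).d + 2) * (F.P p.K).L : ℕ) : ℝ) ^ 2) ^ 2 +
        2 / α) * (((2 * (((F.P p.K).d + 3) * (F.P p.K).L + 2) + 1) ^ (F.P p.K).d * (F.P p.K).d ^ 2 : ℕ) : ℝ)) ≤ a₀)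
    (hsmall : ∀ j ∈ J, 4 * (Fintype.card (Fin N) : ℝ) * B ^ 2 *
      (C * ((2 * (Fintype.card (Fin N) : ℝ) * (((F.P p.K).L : ℝ) ^ 2 + 6 * ((((F.P p.K).d + 2) * (F.P p.K).L : ℕ) : ℝ) ^ 2) ^ 2 + 2 / α) *
          (((2 * (((F.P p.K).d + 3) * (F.P p.K).L + 2) + 1) ^ (F.P p.K).d * (F.P p.K).d ^ 2 : ℕ) : ℝ)) *
          (((2 * (((F.P p.K).d + 3) * (F.P p.K).L + 2) + 1) ^ (F.P p.K).d * (F.P p.K).d ^ 2 : ℕ) : ℝ) +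
        Real.log (((F.P p.K).d ^ 2 * (9 * ((F.P p.K).L * ν.M₂ * RkOfRecord (F.P p.K).L ν.r (g (j + 1)))) ^ (F.P p.K).d : ℕ) : ℝ) / δ) ≤
      p0Profile ν.A₀ ν.p₀ (g (j + 1)) ^ 2)
    (K' : ℕ) (E : (j : ℕ) → (Fin j → LabelPat F ν p g) → Finset (LbOfRecord F ν p g j)) (hE : ∀ j ∈ J, ∀ h t, t ∈ E j h → D j ⊆ t.1)
    (hW : ∀ j ∈ J, j < K' → ∀ h : Fin j → LabelPat F ν p g,
      h ∈ admS (labelTowerOfRecord F N ν M p g A₁ (zeta316OfRecord F N ν M A₁)) (labelPattern F ν p g E) j →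
      ∀ a : ℝ, 0 ≤ a → a ≤ a₀ → ∀ X : Finset (Plaq (F.P p.K) j),
        (∀ q ∈ X, ∃ c ∈ cubes32 F ν M p g j (seqOfHist F ν M p g j h),
          ∃ p' ∈ (Finset.univ.filter fun q : Plaq (F.P p.K) (j + 1) => embIter (j + 1) q.src ∈ cubeEnl (F.P p.K) (sideχ F ν p g j) c 4),
            q ∈ boxRegion (emb p'.src) (((F.P p.K).d + 3) * (F.P p.K).L + 2)) →
        ∫ U, Real.exp (a * ((g (j + 1)) ^ 2)⁻¹ * ∑ q ∈ X, (1 - reTr (GaugeField.plaqHol U q))) *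
            (labelTowerOfRecord F N ν M p g A₁ (zeta316OfRecord F N ν M A₁)).eterm ρ₀ j h U ∂(lawOfRecord F N p.K j) ≤
          Real.exp (C * a * X.card) * ∫ U, (labelTowerOfRecord F N ν M p g A₁ (zeta316OfRecord F N ν M A₁)).eterm ρ₀ j h U ∂(lawOfRecord F N p.K j)) :
    ∑ h ∈ admS (labelTowerOfRecord F N ν M p g A₁ (zeta316OfRecord F N ν M A₁)) (labelPattern F ν p g E) K',
        ∫ x, (labelTowerOfRecord F N ν M p g A₁ (zeta316OfRecord F N ν M A₁)).eterm ρ₀ K' h x ∂(lawOfRecord F N p.K K') ≤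
      Real.exp (-(δ * (C * ((2 * (Fintype.card (Fin N) : ℝ) * (((F.P p.K).L : ℝ) ^ 2 + 6 * ((((F.P p.K).d + 2) * (F.P p.K).L : ℕ) : ℝ) ^ 2) ^ 2 +
              2 / α) * (((2 * (((F.P p.K).d + 3) * (F.P p.K).L + 2) + 1) ^ (F.P p.K).d * (F.P p.K).d ^ 2 : ℕ) : ℝ)) *
              (((2 * (((F.P p.K).d + 3) * (F.P p.K).L + 2) + 1) ^ (F.P p.K).d * (F.P p.K).d ^ 2 : ℕ) : ℝ))) / (39 : ℝ) ^ (F.P p.K).d *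
          ∑ j ∈ (Finset.range K').filter (· ∈ J), ((D j).card : ℝ)) *
        ∫ U, ρ₀ U ∂(fieldMeasure (F.P p.K) 0 (SU N)) := by
  -- n20-d's constants and the loss constant `Λ = C·A·M_h²` (left-nested as in module 40 ∕ 48)
  set N' : ℝ := (Fintype.card (Fin N) : ℝ) with hN'
  set Ad : ℝ := 2 * N' * (((F.P p.K).L : ℝ) ^ 2 + 6 * ((((F.P p.K).d + 2) * (F.P p.K).L : ℕ) : ℝ) ^ 2) ^ 2 + 2 / α with hAd
  set Mh : ℝ := (((2 * (((F.P p.K).d + 3) * (F.P p.K).L + 2) + 1) ^ (F.P p.K).d * (F.P p.K).d ^ 2 : ℕ) : ℝ) with hMh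
  set Λ : ℝ := C * (Ad * Mh) * Mh with hΛ
  have hNpos : 0 < N' := by rw [hN', Fintype.card_fin]; exact_mod_cast Nat.pos_of_ne_zero (NeZero.ne N)
  have hAd0 : 0 ≤ Ad := by positivity
  have hMh0 : 0 ≤ Mh := by positivity
  have hΛ0 : 0 ≤ Λ := by positivity
  -- the skeleton of every pinned family (module 51 §1) and the explicit sizes of the canonical regions (module 51 §2)
  choose D' hsub hdisj hK using fun j => exists_canon_skeleton F ν p g j hM₂ (D j)
  set mχ : ℕ → ℕ := fun j => (F.P p.K).d ^ 2 * (9 * ((F.P p.K).L * ν.M₂ * RkOfRecord (F.P p.K).L ν.r (g (j + 1)))) ^ (F.P p.K).d with hmχ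
  have hm : ∀ j ∈ J, ∀ c ∈ D' j,
      (Finset.univ.filter fun q : Plaq (F.P p.K) (j + 1) =>
        embIter (j + 1) q.src ∈ cubeEnl (F.P p.K) (sideχ F ν p g j) c 4).card ≤ mχ j := by
    intro j hj c _
    have hjK : j + 1 ≤ (F.P p.K).m + (F.P p.K).K := by
      have := hJ j hj; rw [T4Family.P_K]; omega
    exact card_canon_le F ν p g j hjK c
  have hm1 : ∀ j, (1 : ℝ) ≤ (mχ j : ℝ) := fun j => one_le_regionSize F ν p g hM₂ j
  have hε0 : ∀ j ∈ J, 0 ≤ epsOfRecord ν g (j + 1) / B := fun j hj =>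
    div_nonneg (pos_of_mul_pos_left (hεη j hj) (sq_nonneg _)).le hB.le
  -- the per-level rate of record on the skeleton
  set rate : ℕ → ℝ := fun j =>
    ((mχ j : ℝ) * Real.exp (Λ * δ - δ * ((g (j + 1)) ^ 2)⁻¹ * ((epsOfRecord ν g (j + 1) / B) ^ 2 / (2 * N')))) ^ (D' j).card
    with hrate_def
  have hrate0 : ∀ j ∈ J, 0 < rate j := fun j _ =>
    pow_pos (mul_pos (lt_of_lt_of_le one_pos (hm1 j)) (Real.exp_pos _)) _
  have key := sum_admS_integral_le_rec_pinnedLevels_hullWindow_of_regularity F N ν M p g A₁ hρ h0 J hJ D'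
    (fun j c => Finset.univ.filter fun q : Plaq (F.P p.K) (j + 1) => embIter (j + 1) q.src ∈ cubeEnl (F.P p.K) (sideχ F ν p g j) c 4)
    mχ (fun j => epsOfRecord ν g (j + 1) / B) hε0 hm (fun j _ c₁ hc₁ c₂ hc₂ hne => hdisj j c₁ hc₁ c₂ hc₂ hne) hεη
    (fun j hj c _ V' U₀ hmin hsm => hThm1 j hj c V' U₀ hmin fun p' hp' => hsm p' ((mem_canon_iff F ν p g j c p').2 hp'))
    (fun _ => α) (fun j => ((g (j + 1)) ^ 2)⁻¹) (fun _ => C) (fun _ => a₀) (fun _ => δ) rate (fun _ _ => hα) (fun _ _ => hguard)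
    (fun j _ => by positivity) (fun _ _ => hC) (fun _ _ => hδ.le) (fun _ _ => hδa)
    (fun j _ => rfl) hrate0 K' E (fun j hj h t ht => (hsub j).trans (hE j hj h t ht))
    (hLSw_of_window F N ν M p g A₁ E D' hW)
  refine key.trans (mul_le_mul_of_nonneg_right ?_ (integral_nonneg h0))
  -- level by level: `rate j ≤ exp(−δΛ·#D′_j)` (module 47 §1 at the exact gain `p₀(g)²∕B²`, the surplus `log m_j` of the threshold pays the entropy `m_j`)
  have hlevel : ∀ j ∈ J, rate j ≤ Real.exp (-(δ * Λ) * (D' j).card) := by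
    intro j hj
    have hgj := hg j hj
    have hPj := hsmall j hj
    have h1 := pow_mul_exp_le_exp_neg_mul (m := (mχ j : ℝ)) (Λ := Λ) (β := ((g (j + 1)) ^ 2)⁻¹) (ε := epsOfRecord ν g (j + 1) / B)
      (P := p0Profile ν.A₀ ν.p₀ (g (j + 1)) ^ 2) (hm1 j) hδ hNpos hB
      (by rw [inv_sq_mul_div_sq ν g (j + 1) hgj.ne']) hPj (D' j).card
    refine h1.trans (Real.exp_le_exp.2 (mul_le_mul_of_nonneg_right (neg_le_neg ?_) (Nat.cast_nonneg _)))
    -- `δΛ ≤ δ·p₀²∕(4NB²)` from the threshold and `0 ≤ log m_j`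
    have hlogm : 0 ≤ Real.log (mχ j : ℝ) := Real.log_nonneg (hm1 j)
    have h4 : 0 < 4 * N' * B ^ 2 := by positivity
    rw [le_div_iff₀ h4]
    have h5 : 4 * N' * B ^ 2 * Λ ≤ 4 * N' * B ^ 2 * (Λ + Real.log (mχ j : ℝ) / δ) :=
      mul_le_mul_of_nonneg_left (le_add_of_nonneg_right (div_nonneg hlogm hδ.le)) h4.le
    nlinarith [h5, hPj, hδ]
  -- the product over the pinned levels, and the skeleton density `#D_j ≤ 39^d·#D′_j`
  have hK0 : (0 : ℝ) < (39 : ℝ) ^ (F.P p.K).d := by positivity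
  calc ∏ j ∈ (Finset.range K').filter (· ∈ J), rate j
      ≤ ∏ j ∈ (Finset.range K').filter (· ∈ J), Real.exp (-(δ * Λ) * (D' j).card) :=
        Finset.prod_le_prod (fun j hj => (hrate0 j (Finset.mem_filter.1 hj).2).le) fun j hj => hlevel j (Finset.mem_filter.1 hj).2
    _ = Real.exp (-(δ * Λ) * ∑ j ∈ (Finset.range K').filter (· ∈ J), ((D' j).card : ℝ)) := by
        rw [Finset.mul_sum, Real.exp_sum]
    _ ≤ Real.exp (-(δ * Λ) / (39 : ℝ) ^ (F.P p.K).d * ∑ j ∈ (Finset.range K').filter (· ∈ J), ((D j).card : ℝ)) := by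
        refine Real.exp_le_exp.2 ?_
        have hsum : ∑ j ∈ (Finset.range K').filter (· ∈ J), ((D j).card : ℝ) ≤
            (39 : ℝ) ^ (F.P p.K).d * ∑ j ∈ (Finset.range K').filter (· ∈ J), ((D' j).card : ℝ) := by
          rw [Finset.mul_sum]
          exact Finset.sum_le_sum fun j _ => by exact_mod_cast hK j
        have hκ : 0 ≤ δ * Λ := mul_nonneg hδ.le hΛ0
        have h1 : δ * Λ / (39 : ℝ) ^ (F.P p.K).d * ∑ j ∈ (Finset.range K').filter (· ∈ J), ((D j).card : ℝ) ≤
            δ * Λ * ∑ j ∈ (Finset.range K').filter (· ∈ J), ((D' j).card : ℝ) := by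
          rw [div_mul_eq_mul_div, div_le_iff₀ hK0]
          calc δ * Λ * ∑ j ∈ (Finset.range K').filter (· ∈ J), ((D j).card : ℝ)
              ≤ δ * Λ * ((39 : ℝ) ^ (F.P p.K).d * ∑ j ∈ (Finset.range K').filter (· ∈ J), ((D' j).card : ℝ)) :=
                mul_le_mul_of_nonneg_left hsum hκ
            _ = δ * Λ * (∑ j ∈ (Finset.range K').filter (· ∈ J), ((D' j).card : ℝ)) * (39 : ℝ) ^ (F.P p.K).d := by ring
        have e1 : -(δ * Λ) * ∑ j ∈ (Finset.range K').filter (· ∈ J), ((D' j).card : ℝ) =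
            -(δ * Λ * ∑ j ∈ (Finset.range K').filter (· ∈ J), ((D' j).card : ℝ)) := by ring
        have e2 : -(δ * Λ) / (39 : ℝ) ^ (F.P p.K).d * ∑ j ∈ (Finset.range K').filter (· ∈ J), ((D j).card : ℝ) =
            -(δ * Λ / (39 : ℝ) ^ (F.P p.K).d * ∑ j ∈ (Finset.range K').filter (· ∈ J), ((D j).card : ℝ)) := by ring
        rw [e1, e2]
        exact neg_le_neg h1

end PerLevel

/-! ## §2 The per-level threshold holds for every sufficiently small coupling: an explicit `g⋆` -/

section Gstar

/-- **`R(g) ≤ L·(log g⁻²)^r` ONCE `(log g⁻²)^r ≥ 1`** (`L ≥ 2`): `R(g) = L^s` with `s` minimal for `(log g⁻²)^r ≤ L^s` ((2.5)), so either `s = 0` or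
`L^{s−1} < (log g⁻²)^r`. [cite: Balaban1988Convergent, (2.5) p.255] -/
theorem RkOfRecord_le_mul_pow {L : ℕ} (hL : 2 ≤ L) (r : ℕ) {g : ℝ} (h1 : 1 ≤ (Real.log (g ^ 2)⁻¹) ^ r) :
    (RkOfRecord L r g : ℝ) ≤ L * (Real.log (g ^ 2)⁻¹) ^ r := by
  obtain ⟨s, hs, -, hmin⟩ := isRj_RkOfRecord hL r g
  have hL1 : (1 : ℝ) ≤ L := by exact_mod_cast (by omega : 1 ≤ L)
  rw [hs]
  rcases s with _ | k
  · simp only [pow_zero, Nat.cast_one]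
    nlinarith
  · -- minimality at `k`: `¬ (log g⁻²)^r ≤ L^k`
    have hk : ¬ (Real.log (g ^ 2)⁻¹) ^ r ≤ ((L ^ k : ℕ) : ℝ) := fun h => by have := hmin k h; omega
    push Not at hk
    push_cast at hk ⊢
    rw [pow_succ, mul_comm]
    exact mul_le_mul_of_nonneg_left hk.le (by positivity)

/-- ★★ **THE PER-LEVEL THRESHOLD HOLDS BELOW AN EXPLICIT `g⋆`.**  For constants `0 < N′, 0 < B, 0 ≤ Λ, 0 < δ, 0 < A₀, 1 ≤ p₀, 1 ≤ d, 2 ≤ L, 1 ≤ M₂` and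
`t₀ := max 1 ((a + b)∕A₀²)` with `a = 4N′B²(Λ + log(d²(9L²M₂)^d)∕δ)`, `b = 4N′B²·(r·d)∕δ`: every coupling `0 < g ≤ exp(−t₀∕2)` satisfies
`4N′B²(Λ + log(d²(9LM₂R(g))^d)∕δ) ≤ p₀(g)²` (`t = log g⁻² ≥ t₀ ≥ 1`; `R(g) ≤ L·t^r`; `log(d²(9LM₂R(g))^d) ≤ log(d²(9L²M₂)^d) + r·d·t`; `a + b·t ≤ (a+b)·t ≤
A₀²·t₀·t ≤ A₀²·t² ≤ A₀²·t^{2p₀} = p₀(g)²`) — print's «for g_k sufficiently small», with a crude explicit `g⋆`. [cite: Balaban1988Convergent, (2.4)–(2.5) p.255; Balaban1989LargeFieldII, p.383 l.21–28] -/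
theorem threshold_le_p0Profile_sq_of_le_gstar {N' B Λ δ A₀ : ℝ} {p₀ d L M₂ : ℕ} (r : ℕ) (hN : 0 < N') (hB : 0 < B) (hΛ : 0 ≤ Λ)
    (hδ : 0 < δ) (hA : 0 < A₀) (hp : 1 ≤ p₀) (hd : 1 ≤ d) (hL : 2 ≤ L) (hM₂ : 1 ≤ M₂) {g : ℝ} (hg0 : 0 < g)
    (hg : g ≤ Real.exp (-(max 1 ((4 * N' * B ^ 2 * (Λ + Real.log ((d ^ 2 * (9 * L * L * M₂) ^ d : ℕ) : ℝ) / δ) +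
        4 * N' * B ^ 2 * ((r * d : ℕ) : ℝ) / δ) / A₀ ^ 2)) / 2)) :
    4 * N' * B ^ 2 * (Λ + Real.log ((d ^ 2 * (9 * (L * M₂ * RkOfRecord L r g)) ^ d : ℕ) : ℝ) / δ) ≤ p0Profile A₀ p₀ g ^ 2 := by
  -- abbreviations
  set K₀ : ℝ := ((d ^ 2 * (9 * L * L * M₂) ^ d : ℕ) : ℝ) with hK₀
  set a : ℝ := 4 * N' * B ^ 2 * (Λ + Real.log K₀ / δ) with ha
  set b : ℝ := 4 * N' * B ^ 2 * ((r * d : ℕ) : ℝ) / δ with hb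
  set t₀ : ℝ := max 1 ((a + b) / A₀ ^ 2) with ht₀
  set t : ℝ := Real.log (g ^ 2)⁻¹ with ht
  have hK₀1 : (1 : ℝ) ≤ K₀ := by
    have : 1 ≤ d ^ 2 * (9 * L * L * M₂) ^ d :=
      Nat.mul_pos (pow_pos (by omega) 2) (pow_pos (Nat.mul_pos (Nat.mul_pos (Nat.mul_pos (by norm_num) (by omega)) (by omega)) (by omega)) _)
    rw [hK₀]
    exact_mod_cast this
  have hlogK₀ : 0 ≤ Real.log K₀ := Real.log_nonneg hK₀1
  have h4 : 0 < 4 * N' * B ^ 2 := by positivity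
  have ha0 : 0 ≤ a := by positivity
  have hb0 : 0 ≤ b := by positivity
  have ht₀1 : 1 ≤ t₀ := le_max_left _ _
  have hab : a + b ≤ A₀ ^ 2 * t₀ := by
    have : (a + b) / A₀ ^ 2 ≤ t₀ := le_max_right _ _
    rwa [div_le_iff₀ (by positivity), mul_comm] at this
  -- `t ≥ t₀ ≥ 1` from `g ≤ exp(−t₀/2)`
  have htt₀ : t₀ ≤ t := by
    have h1 : g ^ 2 ≤ Real.exp (-t₀) := by
      have h2 : g ^ 2 ≤ Real.exp (-t₀ / 2) ^ 2 := pow_le_pow_left₀ hg0.le hg 2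
      rwa [← Real.exp_nat_mul, show ((2 : ℕ) : ℝ) * (-t₀ / 2) = -t₀ by push_cast; ring] at h2
    have h3 : Real.exp t₀ ≤ (g ^ 2)⁻¹ := by
      rw [le_inv_comm₀ (Real.exp_pos _) (by positivity), ← Real.exp_neg]
      exact h1
    rw [ht]
    exact (Real.le_log_iff_exp_le (by positivity)).2 h3
  have ht1 : 1 ≤ t := ht₀1.trans htt₀
  have ht0 : 0 < t := lt_of_lt_of_le one_pos ht1
  -- `R(g) ≤ L·t^r` and the size bound `m(g) ≤ K₀·t^{r d}`
  have htr : 1 ≤ t ^ r := one_le_pow₀ ht1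
  have hR : (RkOfRecord L r g : ℝ) ≤ L * t ^ r := RkOfRecord_le_mul_pow hL r htr
  have hm : ((d ^ 2 * (9 * (L * M₂ * RkOfRecord L r g)) ^ d : ℕ) : ℝ) ≤ K₀ * t ^ (r * d) := by
    rw [hK₀]
    push_cast
    rw [pow_mul, mul_assoc ((d : ℝ) ^ 2), ← mul_pow]
    refine mul_le_mul_of_nonneg_left (pow_le_pow_left₀ (by positivity) ?_ d) (by positivity)
    calc (9 : ℝ) * ((L : ℝ) * M₂ * RkOfRecord L r g) = 9 * L * M₂ * (RkOfRecord L r g : ℝ) := by ring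
      _ ≤ 9 * L * M₂ * (L * t ^ r) := mul_le_mul_of_nonneg_left hR (by positivity)
      _ = 9 * L * L * M₂ * t ^ r := by ring
  have hm1 : (1 : ℝ) ≤ ((d ^ 2 * (9 * (L * M₂ * RkOfRecord L r g)) ^ d : ℕ) : ℝ) := by
    have hR1 : 1 ≤ RkOfRecord L r g := one_le_RkOfRecord (by omega) _ _
    have : 1 ≤ d ^ 2 * (9 * (L * M₂ * RkOfRecord L r g)) ^ d :=
      Nat.mul_pos (pow_pos (by omega) 2) (pow_pos (Nat.mul_pos (by norm_num) (Nat.mul_pos (Nat.mul_pos (by omega) (by omega)) hR1)) _)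
    exact_mod_cast this
  -- `log m(g) ≤ log K₀ + r d t`
  have hlogm : Real.log ((d ^ 2 * (9 * (L * M₂ * RkOfRecord L r g)) ^ d : ℕ) : ℝ) ≤ Real.log K₀ + ((r * d : ℕ) : ℝ) * t := by
    have h1 : Real.log ((d ^ 2 * (9 * (L * M₂ * RkOfRecord L r g)) ^ d : ℕ) : ℝ) ≤ Real.log (K₀ * t ^ (r * d)) :=
      Real.log_le_log (lt_of_lt_of_le one_pos hm1) hm
    have h2 : Real.log (K₀ * t ^ (r * d)) = Real.log K₀ + ((r * d : ℕ) : ℝ) * Real.log t := by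
      rw [Real.log_mul (by positivity) (by positivity), Real.log_pow]
    have h3 : Real.log t ≤ t := (Real.log_le_sub_one_of_pos ht0).trans (by linarith)
    rw [h2] at h1
    have h5 := mul_le_mul_of_nonneg_left h3 (Nat.cast_nonneg (α := ℝ) (r * d))
    linarith
  -- the threshold against `a + b t`
  have hlhs : 4 * N' * B ^ 2 * (Λ + Real.log ((d ^ 2 * (9 * (L * M₂ * RkOfRecord L r g)) ^ d : ℕ) : ℝ) / δ) ≤ a + b * t := by
    have h1 : Real.log ((d ^ 2 * (9 * (L * M₂ * RkOfRecord L r g)) ^ d : ℕ) : ℝ) / δ ≤ (Real.log K₀ + ((r * d : ℕ) : ℝ) * t) / δ :=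
      div_le_div_of_nonneg_right hlogm hδ.le
    have h2 : 4 * N' * B ^ 2 * (Λ + Real.log ((d ^ 2 * (9 * (L * M₂ * RkOfRecord L r g)) ^ d : ℕ) : ℝ) / δ) ≤
        4 * N' * B ^ 2 * (Λ + (Real.log K₀ + ((r * d : ℕ) : ℝ) * t) / δ) :=
      mul_le_mul_of_nonneg_left (by linarith) h4.le
    have e : 4 * N' * B ^ 2 * (Λ + (Real.log K₀ + ((r * d : ℕ) : ℝ) * t) / δ) = a + b * t := by
      rw [ha, hb]
      field_simp
      ring
    linarith
  -- `a + b t ≤ A₀² t^{2p₀} = p₀(g)²`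
  have hprof : p0Profile A₀ p₀ g ^ 2 = A₀ ^ 2 * t ^ (2 * p₀) := by
    unfold p0Profile
    rw [← ht, mul_pow, ← pow_mul, mul_comm p₀ 2]
  rw [hprof]
  calc 4 * N' * B ^ 2 * (Λ + Real.log ((d ^ 2 * (9 * (L * M₂ * RkOfRecord L r g)) ^ d : ℕ) : ℝ) / δ)
      ≤ a + b * t := hlhs
    _ ≤ (a + b) * t := by nlinarith
    _ ≤ A₀ ^ 2 * t₀ * t := mul_le_mul_of_nonneg_right hab ht0.le
    _ = (A₀ ^ 2 * t) * t₀ := by ring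
    _ ≤ (A₀ ^ 2 * t) * t := mul_le_mul_of_nonneg_left htt₀ (by positivity)
    _ = A₀ ^ 2 * t ^ 2 := by ring
    _ ≤ A₀ ^ 2 * t ^ (2 * p₀) := mul_le_mul_of_nonneg_left (pow_le_pow_right₀ ht1 (by omega)) (by positivity)

end Gstar

end Summit.QuantumFields.YangMills.BalabanUVNodes.N20LCSSmallCouplingRegime

end
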